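import Mathlib
import Summits.ValiantsHypothesis.ValiantsHypothesis.Theorems.BarrierLeverPartitionMinorsHitByVPHiddenStatesSecondShellNeighbours
import Summits.ValiantsHypothesis.ValiantsHypothesis.Theorems.BarrierLeverPartitionMinorsHitByVPHiddenStatesSecondShellForcedColliders

/-!
# Route BarrierLever — item `PartitionMinorsHitByVP` (stmt-ValiantsHypothesis-19717), line `hidden-states`:
# ★★ THE BLOCKED-BOTTOM CELL OF THE SECOND SHELL (every `t, h`) — keyed transports and two forced colliders

Helper file (`--supports stmt-ValiantsHypothesis-19717`; cell valiant-natproofs, 𝒟-side door (c), registered line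
`Cruxes/PartitionMinorsHitByVP/Lines/hidden_states.lean` v9; prover seat val-np-p6 gen 20).  Closes NO item; definition-free.

THE CELL (memo HOME/val-np-p6/g20/MEMO-valnp6-g20.md §3, cells AB/CB of the eight-cell decomposition).  Data: a common path node
`b₁ ∈ (C₁∖A₁) ∩ (C₂∖A₂)`, a node `u₂ ≠ b₁` of path 1 that is not a node of path 2, a level-0 attachment `w₀ ∈ A₁∖C₁`, and no
«connector» coordinates (`(C₁∖A₁) ∩ (A₂∖C₂) = (A₁∖C₁) ∩ (C₂∖A₂) = ∅`).  ORIENTATION (keyed transports, `exists_keyed_enum`): both paths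
are increasing for ONE key `κ` with `κ b₁` maximal and `κ u₂` minimal, so `b₁` is the TOP of both paths (a source of the union digraph),
`u₂` is the BOTTOM of path 1 reading `w₀` (and at most one more attachment), and `κ` is a potential (the union digraph is acyclic).
Then for the cross minor `D(A₁ ← C₂)` (if `u₂, w₀ ∈ C₂`: `w₀` is an immobile token) or `D(A₂ ← C₁)` (if `u₂, w₀ ∉ A₂`: `w₀` is dead)
the two forced colliders `b₁, u₂` of `…SecondShellForcedColliders.exists_active_of_source_of_blocked` cannot collide with each other, so
the master template `…SecondShellMasterTemplate.exists_table_secondShell_of_noReduced` serves the family: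
★★ `exists_table_secondShell_blockedBottom`.  Instances: `u₂ ∈ A₂ ∩ C₂`, `w₀ ∈ A₂ ∩ C₂` (cell CB); `u₂, w₀ ∉ A₂ ∪ C₂` (cell AB mirrored).

HONEST LABEL: conjecture-column cells (second shell, every `t, h`); 19717 stays OPEN; nothing on crux 14610 or VP ≠ VNP.
-/

set_option linter.dupNamespace false

namespace Summit.ValiantsHypothesis.ValiantsHypothesis.Theorems.BarrierLever.HiddenStates

open Finset

noncomputable section

namespace SecondShell

open PathTable

variable {α : Type} [DecidableEq α]

/-! ## Keyed enumerations and prescribed attachments -/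

omit [DecidableEq α] in
/-- ★ **keyed enumeration**: a finset is enumerated injectively in increasing order of an injective key `κ`. -/
theorem exists_keyed_enum (Y : Finset α) {n : ℕ} (hY : Y.card = n) (κ : α → ℕ) (hκ : Set.InjOn κ Y) :
    ∃ py : Fin n → α, Function.Injective py ∧ (∀ p, py p ∈ Y) ∧ StrictMono (fun p => κ (py p)) := by
  classical
  have hS : (Y.image κ).card = n := by rw [Finset.card_image_of_injOn hκ, hY]
  let g := (Y.image κ).orderEmbOfFin hS
  have hg : ∀ p, ∃ v ∈ Y, κ v = g p := fun p => by
    have := Finset.orderEmbOfFin_mem (Y.image κ) hS p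
    obtain ⟨v, hv, hvp⟩ := Finset.mem_image.1 this
    exact ⟨v, hv, hvp⟩
  choose py hpyY hpyκ using hg
  have hmono : StrictMono (fun p => κ (py p)) := by
    intro p p' hpp'
    show κ (py p) < κ (py p')
    rw [hpyκ p, hpyκ p']
    exact g.strictMono hpp'
  refine ⟨py, ?_, hpyY, hmono⟩
  intro p p' hpp
  by_contra hne
  rcases lt_or_gt_of_ne hne with hlt | hlt
  · exact absurd (congrArg κ hpp) (ne_of_lt (hmono hlt))
  · exact absurd (congrArg κ hpp) (ne_of_gt (hmono hlt))

/-- the keyed enumeration is onto. -/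
theorem keyed_enum_surj (Y : Finset α) {n : ℕ} (hY : Y.card = n) {py : Fin n → α} (hinj : Function.Injective py)
    (hmem : ∀ p, py p ∈ Y) {v : α} (hv : v ∈ Y) : ∃ p, py p = v := by
  classical
  have himg : (Finset.univ : Finset (Fin n)).image py = Y := by
    apply Finset.eq_of_subset_of_card_le
    · intro x hx; obtain ⟨p, -, rfl⟩ := Finset.mem_image.1 hx; exact hmem p
    · rw [Finset.card_image_of_injective _ hinj, Finset.card_univ, Fintype.card_fin, hY]
  rw [← himg] at hv
  obtain ⟨p, -, hp⟩ := Finset.mem_image.1 hv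
  exact ⟨p, hp⟩

/-- **the top of a keyed enumeration** is the element of maximal key. -/
theorem keyed_enum_last (Y : Finset α) {k : ℕ} (hY : Y.card = k + 1) (κ : α → ℕ) {py : Fin (k + 1) → α}
    (hinj : Function.Injective py) (hmem : ∀ p, py p ∈ Y) (hmono : StrictMono (fun p => κ (py p)))
    {b : α} (hb : b ∈ Y) (hmax : ∀ v ∈ Y, κ v ≤ κ b) : py (Fin.last k) = b := by
  obtain ⟨p₀, hp₀⟩ := keyed_enum_surj Y hY hinj hmem hb
  rcases (Fin.le_last p₀).lt_or_eq with hlt | heq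
  · exfalso
    have h1 : κ (py p₀) < κ (py (Fin.last k)) := hmono hlt
    have h2 := hmax _ (hmem (Fin.last k))
    rw [hp₀] at h1; omega
  · rw [← heq, hp₀]

/-- **the bottom of a keyed enumeration** is the element of minimal key. -/
theorem keyed_enum_zero (Y : Finset α) {k : ℕ} (hY : Y.card = k + 1) (κ : α → ℕ) {py : Fin (k + 1) → α}
    (hinj : Function.Injective py) (hmem : ∀ p, py p ∈ Y) (hmono : StrictMono (fun p => κ (py p)))
    {b : α} (hb : b ∈ Y) (hmin : ∀ v ∈ Y, κ b ≤ κ v) : py 0 = b := by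
  obtain ⟨p₀, hp₀⟩ := keyed_enum_surj Y hY hinj hmem hb
  rcases (Fin.zero_le p₀).lt_or_eq with hlt | heq
  · exfalso
    have h1 : κ (py 0) < κ (py p₀) := hmono hlt
    have h2 := hmin _ (hmem 0)
    rw [hp₀] at h1; omega
  · rw [heq, hp₀]

omit [DecidableEq α] in
/-- ★ **attachments with one prescribed slot**: an injective enumeration of `X` with a prescribed value at index `i₀`. -/
theorem exists_att_prescribed (X : Finset α) {k : ℕ} (hX : X.card = k) {w₀ : α} (hw : w₀ ∈ X) (i₀ : Fin k) :
    ∃ px : Fin k → α, Function.Injective px ∧ (∀ i, px i ∈ X) ∧ px i₀ = w₀ := by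
  classical
  let f := X.equivFinOfCardEq hX
  let j₀ : Fin k := f ⟨w₀, hw⟩
  let px : Fin k → α := fun i => (f.symm (Equiv.swap i₀ j₀ i)).1
  refine ⟨px, ?_, fun i => (f.symm _).2, ?_⟩
  · intro i i' hii'
    have : f.symm (Equiv.swap i₀ j₀ i) = f.symm (Equiv.swap i₀ j₀ i') := Subtype.ext hii'
    exact (Equiv.swap i₀ j₀).injective (f.symm.injective this)
  · show (f.symm (Equiv.swap i₀ j₀ i₀)).1 = w₀
    rw [Equiv.swap_apply_left]
    show (f.symm (f ⟨w₀, hw⟩)).1 = w₀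
    rw [Equiv.symm_apply_apply]

/-! ## ★★ The blocked-bottom cell -/

set_option maxHeartbeats 800000 in
/-- ★★ **SECOND SHELL, BLOCKED BOTTOM, EVERY `t, h`.**  A common node `b₁` of both paths, a node `u₂ ≠ b₁` of path 1 off path 2, an
attachment `w₀ ∈ A₁ ∖ C₁`, no connector coordinates, and either `u₂, w₀ ∈ C₂` (then `D(A₁ ← C₂)` has no reduced configuration) or
`u₂, w₀ ∉ A₂` (then `D(A₂ ← C₁)` has none) ⇒ the second-shell family `B_t(h) ∖ {A₁, A₂} ∪ {C₁, C₂}` is served. -/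
theorem exists_table_secondShell_blockedBottom (h t : ℕ) (A₁ A₂ C₁ C₂ : Finset (Fin h))
    (hA₁ : A₁.card = t) (hA₂ : A₂.card = t) (hC₁ : C₁.card = t + 1) (hC₂ : C₂.card = t + 1)
    (h₁ : ¬ A₁ ⊆ C₁) (h₂ : ¬ A₂ ⊆ C₂) (hA : A₁ ≠ A₂) (hC : C₁ ≠ C₂)
    (hpq₁ : Disjoint (C₁ \ A₁) (A₂ \ C₂)) (hpq₂ : Disjoint (A₁ \ C₁) (C₂ \ A₂))
    {b₁ u₂ w₀ : Fin h} (hb₁ : b₁ ∈ C₁ \ A₁) (hb₂ : b₁ ∈ C₂ \ A₂)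
    (hu₁ : u₂ ∈ C₁ \ A₁) (hu₂ : u₂ ∉ C₂ \ A₂) (hub : u₂ ≠ b₁) (hw : w₀ ∈ A₁ \ C₁)
    (hminor : (u₂ ∈ C₂ ∧ w₀ ∈ C₂) ∨ (u₂ ∉ A₂ ∧ w₀ ∉ A₂))
    {r : ℕ} (u cols : Fin r → Finset (Fin h)) (hu : Function.Injective u)
    (hU : ∀ i, ((u i).card ≤ t ∧ u i ≠ A₁ ∧ u i ≠ A₂) ∨ u i = C₁ ∨ u i = C₂)
    (hcols : ∀ J : Finset (Fin h), J.card ≤ t → ∃ kk, cols kk = J) :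
    ∃ tx : Option (Fin h) → Fin h → ℂ,
      (Matrix.of fun i kk : Fin r => ∏ a ∈ u i, (tx none a + ∑ q ∈ cols kk, tx (some q) a)).det ≠ 0 := by
  classical
  obtain ⟨k₁, j₁, j₁', hk₁, hkj₁, a1, a2, a3, a4⟩ := swap_sizes A₁ C₁ hA₁ hC₁ h₁
  obtain ⟨k₂, j₂, j₂', hk₂, hkj₂, c1, c2, c3, c4⟩ := swap_sizes A₂ C₂ hA₂ hC₂ h₂
  -- the key: `b₁` on top, `u₂` at the bottom, the other nodes by their value, everything else at `0`
  set Y := (C₁ \ A₁) ∪ (C₂ \ A₂) with hYdef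
  let κ : Fin h → ℕ := fun v => if v = b₁ then 2 * h + 2 else if v = u₂ then 1 else if v ∈ Y then (v : ℕ) + 2 else 0
  have hκb : κ b₁ = 2 * h + 2 := by simp [κ]
  have hκu : κ u₂ = 1 := by simp [κ, hub]
  have hκY : ∀ v ∈ Y, v ≠ b₁ → v ≠ u₂ → κ v = (v : ℕ) + 2 := fun v hv h1 h2 => by simp [κ, h1, h2, hv]
  have hκ0 : ∀ v, v ∉ Y → κ v = 0 := by
    intro v hv
    have h1 : v ≠ b₁ := fun h => hv (h ▸ Finset.mem_union_left _ hb₁)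
    have h2 : v ≠ u₂ := fun h => hv (h ▸ Finset.mem_union_left _ hu₁)
    simp [κ, h1, h2, hv]
  have hκpos : ∀ v ∈ Y, 1 ≤ κ v := by
    intro v hv
    by_cases h1 : v = b₁
    · rw [h1, hκb]; omega
    by_cases h2 : v = u₂
    · rw [h2, hκu]
    · rw [hκY v hv h1 h2]; omega
  have hκmax : ∀ v ∈ Y, κ v ≤ κ b₁ := by
    intro v hv
    by_cases h1 : v = b₁
    · rw [h1]
    by_cases h2 : v = u₂
    · rw [h2, hκu, hκb]; omega
    · rw [hκY v hv h1 h2, hκb]; have := v.isLt; omega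
  have hκmin : ∀ v ∈ Y, κ u₂ ≤ κ v := fun v hv => by rw [hκu]; exact hκpos v hv
  have hκinj : Set.InjOn κ Y := by
    intro v hv v' hv' hvv'
    by_cases h1 : v = b₁
    · by_contra hne
      have : κ v' ≤ κ b₁ := hκmax v' hv'
      by_cases h2 : v' = u₂
      · rw [h1, hκb, h2, hκu] at hvv'; omega
      · rw [h1, hκb, hκY v' hv' (fun h => hne (h1.trans h.symm)) h2] at hvv'; have := v'.isLt; omega
    by_cases h1' : v' = b₁
    · by_cases h2 : v = u₂
      · rw [h1', hκb, h2, hκu] at hvv'; omega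
      · rw [h1', hκb, hκY v hv h1 h2] at hvv'; have := v.isLt; omega
    by_cases h2 : v = u₂
    · by_cases h2' : v' = u₂
      · rw [h2, h2']
      · rw [h2, hκu, hκY v' hv' h1' h2'] at hvv'; omega
    by_cases h2' : v' = u₂
    · rw [h2', hκu, hκY v hv h1 h2] at hvv'; omega
    · rw [hκY v hv h1 h2, hκY v' hv' h1' h2'] at hvv'; exact Fin.ext (by omega)
  -- keyed paths and prescribed attachments
  obtain ⟨py₁, hinj₁, hmem₁, hmono₁⟩ := exists_keyed_enum (C₁ \ A₁) a1 κ
    (fun v hv v' hv' => hκinj (Finset.mem_union_left _ hv) (Finset.mem_union_left _ hv'))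
  obtain ⟨py₂, hinj₂, hmem₂, hmono₂⟩ := exists_keyed_enum (C₂ \ A₂) c1 κ
    (fun v hv v' hv' => hκinj (Finset.mem_union_right _ hv) (Finset.mem_union_right _ hv'))
  obtain ⟨px₁, hpxi₁, hpxm₁, hpx₀⟩ := exists_att_prescribed (A₁ \ C₁) a2 hw ⟨0, hk₁⟩
  obtain ⟨x₂, hx₂⟩ : (A₂ \ C₂).Nonempty := by rw [← Finset.card_pos, c2]; exact hk₂
  obtain ⟨px₂, hpxi₂, hpxm₂, -⟩ := exists_att_prescribed (A₂ \ C₂) c2 hx₂ ⟨0, hk₂⟩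
  obtain ⟨e₁, m1, m2, m3, m4, hpy₁, hpx₁⟩ := exists_equiv_prescribed A₁ C₁ a1 a2 a3 a4 py₁ hinj₁ hmem₁ px₁ hpxi₁ hpxm₁
  obtain ⟨e₂, n1, n2, n3, n4, hpy₂, hpx₂⟩ := exists_equiv_prescribed A₂ C₂ c1 c2 c3 c4 py₂ hinj₂ hmem₂ px₂ hpxi₂ hpxm₂
  have htop₁ : e₁ (Sum.inl (Sum.inl (Fin.last k₁))) = b₁ := by
    rw [hpy₁]; exact keyed_enum_last _ a1 κ hinj₁ hmem₁ hmono₁ hb₁ fun v hv => hκmax v (Finset.mem_union_left _ hv)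
  have htop₂ : e₂ (Sum.inl (Sum.inl (Fin.last k₂))) = b₁ := by
    rw [hpy₂]; exact keyed_enum_last _ c1 κ hinj₂ hmem₂ hmono₂ hb₂ fun v hv => hκmax v (Finset.mem_union_right _ hv)
  have hbot₁ : e₁ (Sum.inl (Sum.inl 0)) = u₂ := by
    rw [hpy₁]; exact keyed_enum_zero _ a1 κ hinj₁ hmem₁ hmono₁ hu₁ fun v hv => hκmin v (Finset.mem_union_left _ hv)
  have hatt₀ : e₁ (Sum.inl (Sum.inr ⟨0, hk₁⟩)) = w₀ := by rw [hpx₁]; exact hpx₀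
  -- disjointness facts
  have hXY₁ : ∀ x ∈ A₁ \ C₁, x ∉ Y := by
    intro x hx hxY
    rcases Finset.mem_union.1 hxY with h' | h'
    · rw [Finset.mem_sdiff] at hx h'; exact h'.2 hx.1
    · exact Finset.disjoint_left.1 hpq₂ hx h'
  have hXY₂ : ∀ x ∈ A₂ \ C₂, x ∉ Y := by
    intro x hx hxY
    rcases Finset.mem_union.1 hxY with h' | h'
    · exact Finset.disjoint_left.1 hpq₁ h' hx
    · rw [Finset.mem_sdiff] at hx h'; exact h'.2 hx.1
  -- the potential: every edge of either transport strictly decreases `κ`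
  have hdag : ∀ a v, a ≠ v → (swapTable' e₁ a v ≠ 0 ∨ swapTable' e₂ a v ≠ 0) → κ v < κ a := by
    intro a v hav hE
    rcases hE with hE | hE
    · have ha : a ∈ C₁ \ A₁ := swapTable'_offdiag A₁ C₁ e₁ m1 hE (Ne.symm hav)
      obtain ⟨p, rfl⟩ := exists_pos_of_mem_Y e₁ m2 m3 m4 ha
      rcases swapTable'_out_of_path e₁ p hE (Ne.symm hav) with ⟨hp, rfl⟩ | ⟨i, -, rfl⟩
      · rw [hpy₁, hpy₁]
        exact hmono₁ (Fin.lt_def.2 (Nat.sub_lt (by omega) Nat.one_pos))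
      · rw [hκ0 _ (hXY₁ _ (m2 i))]
        exact hκpos _ (Finset.mem_union_left _ ha)
    · have ha : a ∈ C₂ \ A₂ := swapTable'_offdiag A₂ C₂ e₂ n1 hE (Ne.symm hav)
      obtain ⟨p, rfl⟩ := exists_pos_of_mem_Y e₂ n2 n3 n4 ha
      rcases swapTable'_out_of_path e₂ p hE (Ne.symm hav) with ⟨hp, rfl⟩ | ⟨i, -, rfl⟩
      · rw [hpy₂, hpy₂]
        exact hmono₂ (Fin.lt_def.2 (Nat.sub_lt (by omega) Nat.one_pos))
      · rw [hκ0 _ (hXY₂ _ (n2 i))]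
        exact hκpos _ (Finset.mem_union_right _ ha)
  -- the union digraph without its diagonal
  let E : Fin h → Fin h → Prop := fun a v => a ≠ v ∧ (swapTable' e₁ a v ≠ 0 ∨ swapTable' e₂ a v ≠ 0)
  -- (N1) the common top is a source
  have hsrc : ∀ w, ¬ E w b₁ := by
    rintro w ⟨hne, hE | hE⟩
    · rw [← htop₁] at hE hne; exact hE (swapTable'_top_col A₁ C₁ e₁ m1 m2 m3 m4 hne)
    · rw [← htop₂] at hE hne; exact hE (swapTable'_top_col A₂ C₂ e₂ n1 n2 n3 n4 hne)
  -- (N2) the out-neighbours of the bottom `u₂` of path 1: its level-0 attachments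
  have hout₀ : ∀ v, E u₂ v → v = w₀ ∨ ∃ hk : 2 ≤ k₁, v = px₁ ⟨1, hk⟩ := by
    rintro v ⟨hne, hE | hE⟩
    · rw [← hbot₁] at hE hne
      obtain ⟨i, hi, rfl⟩ := swapTable'_bottom_row e₁ hE (Ne.symm hne)
      by_cases hi0 : (i : ℕ) = 0
      · left; rw [← hatt₀]; congr 3; exact Fin.ext hi0
      · right; refine ⟨by omega, ?_⟩; rw [hpx₁]; congr 1; exact Fin.ext (by simp; omega)
    · exfalso; rw [row_unit A₂ C₂ e₂ n1 hu₂ v, if_neg (Ne.symm hne)] at hE; exact hE rfl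
  -- (N3) the attachment `w₀` has no out-edge
  have hwY₂ : w₀ ∉ C₂ \ A₂ := fun h => Finset.disjoint_left.1 hpq₂ hw h
  have hw₀out : ∀ w, ¬ E w₀ w := by
    rintro w ⟨hne, hE | hE⟩
    · have hwY₁ : w₀ ∉ C₁ \ A₁ := fun h' => by rw [Finset.mem_sdiff] at hw h'; exact h'.2 hw.1
      rw [row_unit A₁ C₁ e₁ m1 hwY₁ w, if_neg (Ne.symm hne)] at hE; exact hE rfl
    · rw [row_unit A₂ C₂ e₂ n1 hwY₂ w, if_neg (Ne.symm hne)] at hE; exact hE rfl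
  -- (N4) the out-neighbours of the top `b₁`: the second nodes of the two paths (no attachment at the top level)
  have htopout : ∀ v, E b₁ v →
      v = e₁ (Sum.inl (Sum.inl ⟨k₁ - 1, by omega⟩)) ∨ v = e₂ (Sum.inl (Sum.inl ⟨k₂ - 1, by omega⟩)) := by
    rintro v ⟨hne, hE | hE⟩
    · left; rw [← htop₁] at hE hne; exact swapTable'_top_row hk₁ e₁ hE (Ne.symm hne)
    · right; rw [← htop₂] at hE hne; exact swapTable'_top_row hk₂ e₂ hE (Ne.symm hne)
  -- the set of admissible out-neighbours of `u₂`
  let Uok : Finset (Fin h) := if hk : 2 ≤ k₁ then {px₁ ⟨1, hk⟩} else ∅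
  have hUok : Uok.card ≤ 1 := by
    by_cases hk : 2 ≤ k₁
    · simp [Uok, hk]
    · simp [Uok, hk]
  have hUmem : ∀ hk : 2 ≤ k₁, px₁ ⟨1, hk⟩ ∈ Uok := fun hk => by simp [Uok, hk]
  -- (I1) `b₁` steps onto `u₂` only if path 1 has two nodes, and then `u₂` reads `w₀` alone
  have hI₁ : E b₁ u₂ → Uok = ∅ := by
    intro hE
    rcases htopout u₂ hE with h' | h'
    · have hk : ¬ 2 ≤ k₁ := by
        intro hk
        rw [← hbot₁] at h'
        have := congrArg Fin.val (Sum.inl.inj (Sum.inl.inj (e₁.injective h')))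
        simp at this; omega
      simp [Uok, hk]
    · exfalso; exact hu₂ (h' ▸ n1 _)
  -- (I2) `b₁` never steps onto the second attachment
  have hI₂ : ∀ v ∈ Uok, ¬ E b₁ v := by
    intro v hv hE
    by_cases hk : 2 ≤ k₁
    · have hv' : v = px₁ ⟨1, hk⟩ := by simpa [Uok, hk] using hv
      have hvX : v ∈ A₁ \ C₁ := hv' ▸ hpxm₁ _
      rcases htopout v hE with h' | h'
      · have := m1 ⟨k₁ - 1, by omega⟩; rw [← h'] at this
        rw [Finset.mem_sdiff] at hvX this; exact this.2 hvX.1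
      · have := n1 ⟨k₂ - 1, by omega⟩; rw [← h'] at this
        exact Finset.disjoint_left.1 hpq₂ hvX this
    · simp [Uok, hk] at hv
  -- the blocked token: every out-neighbour of `u₂` is `w₀` or lies in `Uok`
  have hout : ∀ v, E u₂ v → v ∈ Uok ∨ v = w₀ := by
    intro v hE
    rcases hout₀ v hE with rfl | ⟨hk, rfl⟩
    · exact Or.inr rfl
    · exact Or.inl (hUmem hk)
  have hbY₂ := hb₂
  rw [Finset.mem_sdiff] at hb₁ hbY₂ hu₁ hw
  -- the master template
  refine exists_table_secondShell_of_noReduced h t A₁ A₂ C₁ C₂ hA₁ hA₂ hC₁ hC₂ hA hC hk₁ hkj₁ hk₂ hkj₂ e₁ m1 m2 m3 m4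
    e₂ n1 n2 n3 n4 κ (fun a v hav hE => hdag a v hav hE) ?_ u cols hu hU hcols
  rcases hminor with ⟨huC₂, hwC₂⟩ | ⟨huA₂, hwA₂⟩
  · -- `D(A₁ ← C₂)`: tokens on `C₂`, targets `A₁`; `w₀` is an immobile token
    left
    intro f g h0 hf hg h3 h4 h5 h6
    refine exists_active_of_source_of_blocked E C₂ A₁ hC₂ f g h0 (fun a ha hne => ⟨Ne.symm hne, hf a ha hne⟩)
      (fun a hne => ⟨Ne.symm hne, hg a hne⟩) h3 h4 h5 h6 hbY₂.1 hb₁.2 huC₂ hu₁.2 (Ne.symm hub) hsrc Uok hUok ?_ hI₁ hI₂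
    intro v hE
    rcases hout v hE with hv | rfl
    · exact Or.inl hv
    · exact Or.inr (Or.inr ⟨hw.1, hwC₂, hw₀out⟩)
  · -- `D(A₂ ← C₁)`: tokens on `C₁`, targets `A₂`; `w₀` is dead
    right
    intro f g h0 hf hg h3 h4 h5 h6
    refine exists_active_of_source_of_blocked E C₁ A₂ hC₁ f g h0 (fun a ha hne => ⟨Ne.symm hne, hf a ha hne⟩)
      (fun a hne => ⟨Ne.symm hne, hg a hne⟩) h3 h4 h5 h6 hb₁.1 hbY₂.2 hu₁.1 huA₂ (Ne.symm hub) hsrc Uok hUok ?_ hI₁ hI₂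
    intro v hE
    rcases hout v hE with hv | rfl
    · exact Or.inl hv
    · exact Or.inr (Or.inl ⟨hwA₂, hw₀out⟩)

end SecondShell

end

end Summit.ValiantsHypothesis.ValiantsHypothesis.Theorems.BarrierLever.HiddenStates
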